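import Summits.AtomisticToContinuum.HydrodynamicLimit.Theorems.RelayRaceLocalityNearConstantShortTimeHLIntCapDefs
import HarnessLib

/-!
# Crux `NearConstantShortTimeHL` (stmt-AtomisticToContinuum-12502), line `small-tilt-domination` — NO SPEED CAP:
# re-typed closure inputs S2⁗/S3⁗ (packing + integrated quartic caps only), the true-law input without the speed cap, and the dynamic theorem
# (typed statements, lead c8, skeleton v20)

Reviewed Defs file of the line (lead prover-line-stmt-AtomisticToContinuum-12502-c8-0). WHY: after v18 (`…IntCapDefs`, `…EndgameI`:
`nearConstantShortTimeHL_of_dynamics3 : MomentumClosureTightnessI → EnergyClosureTightnessI → TrueLawCapsG → crux`) the inputs along the TRUE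
law are the three conjuncts of `TrueLawCapsG`: (a) the SPEED CAP `maxᵢ sup_{r ≤ t} ‖vᵢ(r)‖ ≤ n^{1/24}` with probability `→ 1` (the general-family
twin of `MaxSpeedBoundPreShock`, stmt-9511: "no maximum principle for collision cascades is known"), (b) the ball-packing cap, (c′) Gaussian
velocity tails in mean at fixed times. In the Grönwall assembly (a) has exactly ONE use: on the good event it certifies that the orbit lies in the
conditioning event of the equilibrium closure K-stubs (the deterministic grid / window / cell estimates of `dynamic_theorem4` consume only the
packing cap — `hdefW`/`hdefC` discard the speed component — and the velocity tails enter only through the Gaussian moments in mean). So (a)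
disappears as soon as the K-stub EVENTS drop the speed cap. The re-typed K-stubs S2⁗/S3⁗ below condition on the ball-packing cap and the
INTEGRATED fourth-moment cap only; they are STRONGER than S2‴/S3‴ (larger event, same rate; `momentumClosureTightnessI_of_PQ`). Why they are
still believed (large-deviation pricing under the invariant drifted Gibbs law, rate uniform in the cap level `K`, for every `K` eventually in
`N`): the hot-particle channel that the speed cap used to close is closed by the integrated quartic cap at every scale — `m` particles of speed
`V` carrying a momentum-flux defect `δ` over a window `τ` need `m V² ≍ δ n/τ`; the cap `τ n⁻¹ m V⁴ ≤ K` forces `V² ≤ K/δ`, hence `m ≥ δ² n/(Kτ)`,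
a positive FRACTION of the particles at BOUNDED speeds (for `m = n^α`, `α < 1`, the integrated quartic moment is `δ² n^{1-α}/τ → ∞`; a single
"bullet" carrying energy `f n` has quartic moment `≍ f² n → ∞`); such a fraction must stay out of local equilibrium for the macroscopic time `τ`
(`≫` the mean free time `n^{-1/3}`), i.e. be protected from collisions — the vacuum-gap needle-beam family, whose sub-`ℓ_n` phase-space
localisation costs `≳ (δ²/(Kτ)) n log n`, superlinear; for the cubic energy current `m V³ ≍ δn/τ` and the cap give `V ≤ K/δ`, `m ≥ δ⁴n/(τK³)`,
same conclusion; walls, rafts, contact layers and collisional patterns have thermal quartic moment and never saw the speed cap either. The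
matching true-law input is `TrueLawCapsPG` = `TrueLawCapsG` without (a) (so `TrueLawCapsG → TrueLawCapsPG`, `trueLawCapsPG_of_G`), and the
dynamic theorem `DynamicTheoremPQ` = `DynamicTheoremI` without the speed-cap failure hypothesis `hcapV` and without `speedCapOn` in the events of
`hKmom`/`hKen` (proof, file `…DynamicPQ`: the landed proof over `good_event_packagePQ`, whose conclusion drops the unused speed cap on the good
event). Net effect (file `…EndgamePQ`, to land): `MomentumClosureTightnessPQ → EnergyClosureTightnessPQ → TrueLawCapsPG → NearConstantShortTimeHL`
— the only inputs along the true law are the ball-packing cap (the twin of `NoDenseInclusions`, stmt-14425) and Gaussian velocity tails in mean.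

Contents (statements only, no mathematics): `MomentumClosureTightnessPQ` (S2⁗), `EnergyClosureTightnessPQ` (S3⁗), `TrueLawCapsPG` (S4″),
`DynamicTheoremPQ`. PROVED (sanity of the re-typing): `momentumClosureTightnessI_of_PQ`, `energyClosureTightnessI_of_PQ` (the new K-stubs imply
the v18 ones), `trueLawCapsPG_of_G` (the new true-law input is implied by the v18 one).
References: H.-T. Yau, Lett. Math. Phys. 22 (1991) §2; C. Kipnis – C. Landim (1999) Ch. 10 Thm 3.1 (stochastic template).
-/

noncomputable section

namespace Summit.AtomisticToContinuum.HydrodynamicLimit.Theorems.NearConstantShortTimeHL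

open scoped BigOperators ENNReal
open MeasureTheory Set Filter Topology
open Literature.MathematicalPhysics.KineticTheory Literature.Analysis.FluidPDE Literature.Analysis.FunctionSpaces

/-- **S2⁗ — MOMENTUM CLOSURE TIGHTNESS AT A UNIFORM RATE UNDER THE PACKING AND INTEGRATED FOURTH-MOMENT CAPS ONLY** (K-stub of skeleton
v20; OPEN, delegated-grade). Verbatim `MomentumClosureTightnessI` (S2‴) with the speed cap `speedCapOn … n^{1/24}` REMOVED from the conditioning
event (so the event is larger and the statement stronger; the rate `c₀(M)` is still chosen right after `M` and the cap level `K` innermost).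
Cheap witnesses: as for S2‴; the hot-particle channel (few fast particles, formerly excluded by the speed cap) is closed by the integrated quartic
cap at every scale — see the module docstring. [cite: Yau1991, §2] -/
@[conjecture] def MomentumClosureTightnessPQ : Prop :=
  ∃ η₁ : ℝ, 0 < η₁ ∧ ∀ M : ℝ, 1 ≤ M → ∃ c₀ : ℝ, 0 < c₀ ∧ ∀ (abar θe : ℝ) (ubar : V3),
    M⁻¹ ≤ abar → abar ≤ M → M⁻¹ ≤ θe → θe ≤ M → ‖ubar‖ ≤ M →
    ∃ σ₀ : ℝ, 0 < σ₀ ∧ ∀ σ : ℝ, 0 < σ → σ < σ₀ →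
    ∀ (ε : ℕ → ℝ) (n : ℕ → ℕ), (∀ N, 0 < ε N) → Tendsto ε atTop (nhds 0) →
    Tendsto (fun N => (n N : ℝ) * ε N ^ 3) atTop (nhds (σ ^ 3)) →
    ∀ Φ : (N : ℕ) → HardSphereFlow (Torus.geometry (Fin 3)) (ε N) (n N),
    ∀ (s τ : ℝ), 0 ≤ s → 0 < τ → s + τ ≤ 1 →
    ∀ ψ : ℝ → T3 → V3, Torus.IsSmoothSpaceTimeOn (Set.Icc s (s + τ)) ψ →
    (∀ r ∈ Set.Icc s (s + τ), ∀ x, ‖ψ r x‖ ≤ 1 ∧ ‖Torus.timeDerivWithin (Set.Icc s (s + τ)) ψ r x‖ ≤ 1 ∧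
      ∀ i, ‖Torus.partialDeriv i (ψ r) x‖ ≤ 1) →
    ∀ δ : ℝ, 0 < δ → ∀ K : ℝ, 0 < K → ∀ᶠ N : ℕ in atTop,
      particleLaw (Φ N) (canonicalDensity (Torus.geometry (Fin 3)) (ε N) (n N)
          (localGibbsProfile (fun _ => abar) (fun _ => ubar) (fun _ => θe)))
        {z | packCapOn (Φ N) z (Set.Icc s (s + τ)) (mesoRadius (n N)) σ η₁ ∧
             intMomentCapOn (Φ N) z (Set.Icc s (s + τ)) K ∧
             δ < |momDefect σ (Φ N) z (mesoRadius (n N)) s τ ψ|}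
        ≤ ENNReal.ofReal (Real.exp (-(c₀ * n N)))


/-- **S3⁗ — ENERGY CLOSURE TIGHTNESS AT A UNIFORM RATE UNDER THE PACKING AND INTEGRATED FOURTH-MOMENT CAPS ONLY** (the energy twin of
S2⁗: `EnergyClosureTightnessI` with the speed cap removed from the event; OPEN, delegated-grade). Hot jets carrying the cubic current need
`m V³ ≍ δn/τ`, and the integrated quartic cap forces `V ≤ K/δ`, `m ≥ δ⁴ n/(τK³)` — a protected beam fraction, superlinear cost. [cite: Yau1991, §2] -/
@[conjecture] def EnergyClosureTightnessPQ : Prop :=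
  ∃ η₁ : ℝ, 0 < η₁ ∧ ∀ M : ℝ, 1 ≤ M → ∃ c₀ : ℝ, 0 < c₀ ∧ ∀ (abar θe : ℝ) (ubar : V3),
    M⁻¹ ≤ abar → abar ≤ M → M⁻¹ ≤ θe → θe ≤ M → ‖ubar‖ ≤ M →
    ∃ σ₀ : ℝ, 0 < σ₀ ∧ ∀ σ : ℝ, 0 < σ → σ < σ₀ →
    ∀ (ε : ℕ → ℝ) (n : ℕ → ℕ), (∀ N, 0 < ε N) → Tendsto ε atTop (nhds 0) →
    Tendsto (fun N => (n N : ℝ) * ε N ^ 3) atTop (nhds (σ ^ 3)) →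
    ∀ Φ : (N : ℕ) → HardSphereFlow (Torus.geometry (Fin 3)) (ε N) (n N),
    ∀ (s τ : ℝ), 0 ≤ s → 0 < τ → s + τ ≤ 1 →
    ∀ φ : ℝ → T3 → ℝ, Torus.IsSmoothSpaceTimeOn (Set.Icc s (s + τ)) φ →
    (∀ r ∈ Set.Icc s (s + τ), ∀ x, |φ r x| ≤ 1 ∧ |Torus.timeDerivWithin (Set.Icc s (s + τ)) φ r x| ≤ 1 ∧
      ∀ i, |Torus.partialDeriv i (φ r) x| ≤ 1) →
    ∀ δ : ℝ, 0 < δ → ∀ K : ℝ, 0 < K → ∀ᶠ N : ℕ in atTop,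
      particleLaw (Φ N) (canonicalDensity (Torus.geometry (Fin 3)) (ε N) (n N)
          (localGibbsProfile (fun _ => abar) (fun _ => ubar) (fun _ => θe)))
        {z | packCapOn (Φ N) z (Set.Icc s (s + τ)) (mesoRadius (n N)) σ η₁ ∧
             intMomentCapOn (Φ N) z (Set.Icc s (s + τ)) K ∧
             δ < |enDefect σ (Φ N) z (mesoRadius (n N)) s τ φ|}
        ≤ ENNReal.ofReal (Real.exp (-(c₀ * n N)))


/-- **S4″ — A-PRIORI CAPS ALONG THE TRUE LAW WITHOUT THE SPEED CAP, general families** (input of skeleton v20): verbatim `TrueLawCapsG`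
(`…AssemblyDefs`) with conjunct (a) — the speed cap `n^{1/24}` — REMOVED from the conclusion; what remains is (b) the BALL-PACKING CAP `η₁` at
radius `n^{-1/4}` fails somewhere on `[0,t]` with probability `→ 0` (the general-family twin of `NoDenseInclusions`, stmt-14425) and (c′) GAUSSIAN
VELOCITY TAILS IN MEAN, uniformly on `[0,t]`: for some `a > 0` and `A`, eventually in `N`, `E_{P_N}[n⁻¹ Σᵢ exp(a ‖vᵢ(s)‖²)] ≤ A` for all
`s ∈ [0,t]` (true at `t = 0` for `a < (2 sup θ₀)⁻¹`; the pre-shock Gaussian-tail bet; not transferable from equilibrium; barrier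
`HighMomentumCutoffBarrierNarrow` OPEN, not evaded). [cite: Yau1991, §2] [cite: OllaVaradhanYau1993, §1] -/
@[conjecture] def TrueLawCapsPG : Prop :=
  ∀ η₁ : ℝ, 0 < η₁ → ∀ (a₀ θ₀ : T3 → ℝ) (u₀ : T3 → V3), Continuous a₀ → Continuous θ₀ → Continuous u₀ →
    (∀ x, 0 < a₀ x) → (∀ x, 0 < θ₀ x) → ∃ σ₀ : ℝ, 0 < σ₀ ∧ ∀ σ : ℝ, 0 < σ → σ < σ₀ →
    ∀ (ε : ℕ → ℝ) (n : ℕ → ℕ), (∀ N, 0 < ε N) → Tendsto ε atTop (nhds 0) →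
    Tendsto (fun N => (n N : ℝ) * ε N ^ 3) atTop (nhds (σ ^ 3)) →
    ∀ (T : ℝ) (ρ θ : ℝ → T3 → ℝ) (u : ℝ → T3 → V3), IsHardSphereEulerSolution σ T ρ u θ →
    ∀ Φ : (N : ℕ) → HardSphereFlow (Torus.geometry (Fin 3)) (ε N) (n N),
    let P : (N : ℕ) → Measure (Config (n N) (Fin 3) T3) := fun N =>
      particleLaw (Φ N) (canonicalDensity (Torus.geometry (Fin 3)) (ε N) (n N) (localGibbsProfile a₀ u₀ θ₀));
    (∀ N, IsProbabilityMeasure (P N)) →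
    (∀ χ : T3 → ℝ, Continuous χ → ∀ δ : ℝ, 0 < δ →
      Tendsto (fun N => P N {z | δ < |empiricalDensityField ((Φ N).flow 0 z) χ - ∫ x, χ x * ρ 0 x|}) atTop (nhds 0) ∧
      Tendsto (fun N => P N {z | δ < ‖empiricalMomentumField ((Φ N).flow 0 z) χ - ∫ x, (χ x * ρ 0 x) • u 0 x‖}) atTop (nhds 0) ∧
      Tendsto (fun N => P N {z | δ < |empiricalEnergyField ((Φ N).flow 0 z) χ -
        ∫ x, χ x * totalEnergyDensity (ρ 0 x) (u 0 x) (θ 0 x)|}) atTop (nhds 0)) →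
    ∀ t ∈ Set.Ico 0 T, (∀ s ∈ Set.Icc 0 t, ∀ x, ρ s x * σ ^ 3 ≤ η₁ / 2) →
      Tendsto (fun N => P N {z | ∃ r ∈ Set.Icc 0 t, ∃ x : T3,
        η₁ < empiricalDensityField ((Φ N).flow r z)
          (fun y => if Torus.euclidDist x y < (n N : ℝ) ^ (-(1 / 4 : ℝ))
            then (4 / 3 * Real.pi * ((n N : ℝ) ^ (-(1 / 4 : ℝ))) ^ 3)⁻¹ else 0) * σ ^ 3}) atTop (nhds 0) ∧
      (∃ a : ℝ, 0 < a ∧ ∃ A : ℝ, ∀ᶠ N : ℕ in atTop, ∀ s ∈ Set.Icc 0 t,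
        ∫⁻ z, ENNReal.ofReal ((n N : ℝ)⁻¹ * ∑ i : Fin (n N), Real.exp (a * ‖((Φ N).flow s z i).2‖ ^ 2)) ∂(P N) ≤
          ENNReal.ofReal A)


/-- **THE DYNAMIC THEOREM AT FIXED DATA WITHOUT THE SPEED CAP** (level 1 of the Grönwall assembly of skeleton v20): verbatim `DynamicTheoremI`
(`…IntCapDefs`) with (i) the speed-cap failure hypothesis `hcapV` REMOVED and (ii) the conjunct `speedCapOn …` REMOVED from the events of the two
equilibrium closure bounds `hKmom` / `hKen`. Same conclusion. Proof (file `…DynamicPQ`): the landed proof of `stub_dynamicI` over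
`good_event_packagePQ` (bad sets = packing-cap failure ∪ integrated-cap failure; the good event no longer records a speed cap, which the grid,
window and cell estimates never used). [cite: Yau1991, §2] -/
@[conjecture] def DynamicTheoremPQ : Prop :=
    ∀ {η₀ : ℝ} {F : ℝ → ℝ} (hη₀ : 0 < η₀) (hFa : AnalyticOnNhd ℝ F (Set.Ioo (-η₀) η₀))
    (hEq : Set.EqOn hsExcessFreeEnergy F (Set.Ico 0 η₀))
    {σ T : ℝ} (hσ : 0 < σ) {ρ θ : ℝ → T3 → ℝ} {u : ℝ → T3 → V3} (hE : IsHardSphereEulerSolution σ T ρ u θ)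
    {t : ℝ} (ht : t ∈ Set.Ico 0 T) (ht1 : t < 1) (hband : ∀ s ∈ Set.Icc 0 t, ∀ x, ρ s x * σ ^ 3 < η₀)
    (hmass : ∫ x, ρ 0 x = 1)
    {ηP : ℝ} (hηP : 0 < ηP) (hηP₀ : ηP < η₀)
    {ε : ℕ → ℝ} {n : ℕ → ℕ} (hn : Tendsto n atTop atTop) (hε : ∀ N, 0 < ε N)
    (Φ : (N : ℕ) → HardSphereFlow (Torus.geometry (Fin 3)) (ε N) (n N))
    (P : (N : ℕ) → Measure (Config (n N) (Fin 3) T3))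
    (hPdef : ∀ N, P N = particleLaw (Φ N) (canonicalDensity (Torus.geometry (Fin 3)) (ε N) (n N)
    (localGibbsProfile (fun x => ρ 0 x * Real.exp (gChem σ (ρ 0 x))) (u 0) (θ 0))))
    (hP : ∀ N, IsProbabilityMeasure (P N))
    {π₀ : ℝ} {πst : ℝ → ℝ}
    (hπ₀ : Tendsto (fun N => (n N : ℝ)⁻¹ * Real.log (canonicalPartition (Torus.geometry (Fin 3)) (ε N) (n N)
    (localGibbsProfile (fun x => ρ 0 x * Real.exp (gChem σ (ρ 0 x))) (u 0) (θ 0)))) atTop (nhds π₀))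
    (hπ : TendstoUniformlyOn (fun N r => (n N : ℝ)⁻¹ * Real.log (canonicalPartition (Torus.geometry (Fin 3)) (ε N) (n N)
    (localGibbsProfile (fun x => ρ r x * Real.exp (gChem σ (ρ r x))) (u r) (θ r)))) πst atTop (Set.Icc 0 t))
    (hm₀ : Tendsto (fun N => ∫ z, logProfileObs σ ρ θ u 0 z ∂(P N)) atTop
    (nhds (∫ x, ρ 0 x * (Real.log (ρ 0 x) + gChem σ (ρ 0 x) - 3 / 2 * Real.log (2 * Real.pi * θ 0 x) - 3 / 2))))
    (hm₀i : ∀ᶠ N : ℕ in atTop, Integrable (fun z => logProfileObs σ ρ θ u 0 z) (P N))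
    (hiso : ∀ r ∈ Set.Icc 0 t,
    (∫ x, ρ 0 x * (Real.log (ρ 0 x) + gChem σ (ρ 0 x) - 3 / 2 * Real.log (2 * Real.pi * θ 0 x) - 3 / 2)) - π₀ =
    (∫ x, ρ r x * (Real.log (ρ r x) + gChem σ (ρ r x) - 3 / 2 * Real.log (2 * Real.pi * θ r x) - 3 / 2)) - πst r)
    {γ : ℝ} (hγ : 0 < γ)
    (hSt2 : ∀ κ : ℝ, 0 < κ → ∀ᶠ N : ℕ in atTop, ∀ r ∈ Set.Icc 0 t,
    ∫⁻ w, ENNReal.ofReal (Real.exp (γ * (n N : ℝ) * fluctuationE (mesoRadius (n N)) (ρ r) (θ r) (u r) w))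
    ∂(particleLaw (Φ N) (canonicalDensity (Torus.geometry (Fin 3)) (ε N) (n N)
    (localGibbsProfile (fun x => ρ r x * Real.exp (gChem σ (ρ r x))) (u r) (θ r)))) ≤
    ENNReal.ofReal (Real.exp (κ * (n N : ℝ))))
    (hcapP : Tendsto (fun N => P N {z | ∃ r ∈ Set.Icc 0 t, ∃ x : T3,
    ηP < empiricalDensityField ((Φ N).flow r z) (ballKernel (mesoRadius (n N)) x) * σ ^ 3}) atTop (nhds 0))
    {C₄ : ℝ} (hC₄ : 0 ≤ C₄)
    (hcapI : ∀ K : ℝ, 0 < K → ∀ᶠ N : ℕ in atTop, P N {z | ENNReal.ofReal K <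
      ∫⁻ r in Set.Icc 0 t, ENNReal.ofReal ((n N : ℝ)⁻¹ * ∑ i : Fin (n N), ‖((Φ N).flow r z i).2‖ ^ 4)} ≤
      ENNReal.ofReal (C₄ / K))
    {a A : ℝ} (ha : 0 < a) (hA : 0 ≤ A)
    (hgauss : ∀ᶠ N : ℕ in atTop, ∀ s ∈ Set.Icc 0 t,
    ∫⁻ z, ENNReal.ofReal ((n N : ℝ)⁻¹ * ∑ i : Fin (n N), Real.exp (a * ‖((Φ N).flow s z i).2‖ ^ 2)) ∂(P N) ≤
    ENNReal.ofReal A)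
    (G : (N : ℕ) → Measure (Config (n N) (Fin 3) T3)) {aI c₀ : ℝ} (haI : aI < c₀)
    (hImp : ∀ N (S : Set (Config (n N) (Fin 3) T3)), P N S ≤ ENNReal.ofReal (Real.exp (aI * n N)) * G N S)
    {η₂ η₃ : ℝ} (hη₂ : ηP ≤ η₂) (hη₃ : ηP ≤ η₃)
    (hKmom : ∀ K : ℝ, 0 < K → ∀ (s τ : ℝ), 0 ≤ s → 0 < τ → s + τ ≤ 1 →
    ∀ ψ : ℝ → T3 → V3, Torus.IsSmoothSpaceTimeOn (Set.Icc s (s + τ)) ψ →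
    (∀ r ∈ Set.Icc s (s + τ), ∀ x, ‖ψ r x‖ ≤ 1 ∧ ‖Torus.timeDerivWithin (Set.Icc s (s + τ)) ψ r x‖ ≤ 1 ∧
    ∀ i, ‖Torus.partialDeriv i (ψ r) x‖ ≤ 1) →
    ∀ δ : ℝ, 0 < δ → ∀ᶠ N : ℕ in atTop,
    G N {z | packCapOn (Φ N) z (Set.Icc s (s + τ)) (mesoRadius (n N)) σ η₂ ∧
    intMomentCapOn (Φ N) z (Set.Icc s (s + τ)) K ∧
    δ < |momDefect σ (Φ N) z (mesoRadius (n N)) s τ ψ|} ≤ ENNReal.ofReal (Real.exp (-(c₀ * n N))))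
    (hKen : ∀ K : ℝ, 0 < K → ∀ (s τ : ℝ), 0 ≤ s → 0 < τ → s + τ ≤ 1 →
    ∀ φ : ℝ → T3 → ℝ, Torus.IsSmoothSpaceTimeOn (Set.Icc s (s + τ)) φ →
    (∀ r ∈ Set.Icc s (s + τ), ∀ x, |φ r x| ≤ 1 ∧ |Torus.timeDerivWithin (Set.Icc s (s + τ)) φ r x| ≤ 1 ∧
    ∀ i, |Torus.partialDeriv i (φ r) x| ≤ 1) →
    ∀ δ : ℝ, 0 < δ → ∀ᶠ N : ℕ in atTop,
    G N {z | packCapOn (Φ N) z (Set.Icc s (s + τ)) (mesoRadius (n N)) σ η₃ ∧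
    intMomentCapOn (Φ N) z (Set.Icc s (s + τ)) K ∧
    δ < |enDefect σ (Φ N) z (mesoRadius (n N)) s τ φ|} ≤ ENNReal.ofReal (Real.exp (-(c₀ * n N)))),
    ∀ κ : ℝ, 0 < κ → ∀ᶠ N in atTop,
    Integrable (fun z => logProfileObs σ ρ θ u t ((Φ N).flow t z)) (P N) ∧
    (∫ x, ρ t x * (Real.log (ρ t x) + gChem σ (ρ t x) - 3 / 2 * Real.log (2 * Real.pi * θ t x) - 3 / 2)) - κ ≤
    ∫ z, logProfileObs σ ρ θ u t ((Φ N).flow t z) ∂(P N)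


/-! ## The re-typed statements against the v18 ones -/

/-- **S2⁗ ⇒ S2‴**: removing the speed cap from the conditioning event enlarges it, so the new K-stub implies `MomentumClosureTightnessI`.
[folklore] -/
theorem momentumClosureTightnessI_of_PQ : MomentumClosureTightnessPQ → MomentumClosureTightnessI := by
  rintro ⟨η₁, hη₁, H⟩
  refine ⟨η₁, hη₁, fun M hM => ?_⟩
  obtain ⟨c₀, hc₀, H'⟩ := H M hM
  refine ⟨c₀, hc₀, fun abar θe ubar h1 h2 h3 h4 h5 => ?_⟩
  obtain ⟨σ₀, hσ₀, H''⟩ := H' abar θe ubar h1 h2 h3 h4 h5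
  refine ⟨σ₀, hσ₀, fun σ hσ hσ' ε n hε hε0 hn Φ s τ hs hτ hst ψ hψ hψb δ hδ K hK => ?_⟩
  exact (H'' σ hσ hσ' ε n hε hε0 hn Φ s τ hs hτ hst ψ hψ hψb δ hδ K hK).mono fun N hN => by
    refine le_trans (measure_mono fun z hz => ?_) hN
    simp only [Set.mem_setOf_eq] at hz ⊢
    exact ⟨hz.2.1, hz.2.2.1, hz.2.2.2⟩

/-- **S3⁗ ⇒ S3‴** likewise. [folklore] -/
theorem energyClosureTightnessI_of_PQ : EnergyClosureTightnessPQ → EnergyClosureTightnessI := by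
  rintro ⟨η₁, hη₁, H⟩
  refine ⟨η₁, hη₁, fun M hM => ?_⟩
  obtain ⟨c₀, hc₀, H'⟩ := H M hM
  refine ⟨c₀, hc₀, fun abar θe ubar h1 h2 h3 h4 h5 => ?_⟩
  obtain ⟨σ₀, hσ₀, H''⟩ := H' abar θe ubar h1 h2 h3 h4 h5
  refine ⟨σ₀, hσ₀, fun σ hσ hσ' ε n hε hε0 hn Φ s τ hs hτ hst φ hφ hφb δ hδ K hK => ?_⟩
  exact (H'' σ hσ hσ' ε n hε hε0 hn Φ s τ hs hτ hst φ hφ hφb δ hδ K hK).mono fun N hN => by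
    refine le_trans (measure_mono fun z hz => ?_) hN
    simp only [Set.mem_setOf_eq] at hz ⊢
    exact ⟨hz.2.1, hz.2.2.1, hz.2.2.2⟩

/-- **S4′ ⇒ S4″**: the true-law input of v18 implies the one of v20 (drop the speed-cap conjunct). [folklore] -/
theorem trueLawCapsPG_of_G : TrueLawCapsG → TrueLawCapsPG := by
  intro H η₁ hη₁ a₀ θ₀ u₀ ha hθ hu ha0 hθ0
  obtain ⟨σ₀, hσ₀, H'⟩ := H η₁ hη₁ a₀ θ₀ u₀ ha hθ hu ha0 hθ0
  refine ⟨σ₀, hσ₀, fun σ hσ hσ' ε n hε hε0 hn T ρ θ u hE Φ => ?_⟩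
  have H'' := H' σ hσ hσ' ε n hε hε0 hn T ρ θ u hE Φ
  dsimp only at H'' ⊢
  intro hP h0 t ht hpack
  exact (H'' hP h0 t ht hpack).2

end Summit.AtomisticToContinuum.HydrodynamicLimit.Theorems.NearConstantShortTimeHL

end
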